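import Literature.NumberTheory.Automorphic.HeckeOperatorUnitaryAdjoint
import Literature.NumberTheory.Automorphic.IrreducibleClassesUnitarizable
import Literature.Analysis.InnerProduct.TracePolynomialPositiveOperator
import Mathlib.Analysis.Normed.Module.FiniteDimension
import HarnessLib

/-!
# Linear independence of the characters of COUNTABLY many pairwise non-isomorphic irreducible admissible UNITARY representations of a
# totally disconnected group ([Jacquet–Langlands 1970, Lemma 16.1.1]; Rogawski's Prop. 13.8.1 with `Z = 1`)

Topic `NumberTheory/Automorphic`; namespace `Literature.NumberTheory.Automorphic`.  THEOREMS ONLY (no definition, no instance, no notation,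
no named fact, no `sorry`).  The COUNTABLE ∕ UNITARY sequel of ★ `SmoothTraceLinearIndependence` (Getz–Hahn Prop. 8.5.2, finite families, no
unitarity); cell `hodgecm-mathlib` (D-0151), floor 0, programme P3 rung 4 (F0P3-plan (g4) RULING (V17)), file (U3) of the in-house discharge of the
letter ★ `unitaryCharactersLinearIndependent` (the instantiation at `∏_{v ∈ S} U(H)(L⁺_v)` is file (U4) `UnitaryCharactersLinearIndependentProofs`).

THE STATEMENT (§1): `G` a topological group with a compact open subgroup `K₀`, `μ` a left-invariant measure finite on compacta and positive on
opens; `ρᵢ` (`i ∈ ι`, `ι` COUNTABLE) pairwise non-isomorphic irreducible ADMISSIBLE UNITARIZABLE representations on complex spaces; `a : ι → ℂ`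
with `i ↦ aᵢ · tr ρᵢ(f)` summable with sum `0` for every test function `f ∈ C_c^∞(G)` (★ `SchwartzBruhat`).  Then `a = 0`.  §2: the same on
isomorphism classes (★ `IrrClass.smoothTrace`, `IsAdmissible`, `IsUnitarizable`).

THE PROOF ([JacquetLanglands1970] 16.1.1 through POSITIVITY; no `C*`-algebras, no Plancherel measure, NO unimodularity).  Fix `i₀`, a level `K` with
`V_{i₀}^K ≠ 0`; `A := ℋ(G,K)ᵐᵒᵖ` acts on every `Vᵢ^K` (★ `heckeAlgebra.fixedPointsAlgHom`), simply and pairwise non-isomorphically on the non-zero ones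
(★ `isSimpleModule_fixedPoints`, ★ `nonempty_equiv_of_heckeEquivariant_fixedPoints`).  (1) `f := 𝟙_K` ⇒ `Σᵢ ‖aᵢ‖·dim Vᵢ^K < ∞` (★ `smoothTrace_indicator`,
Mathlib ★ `summable_norm_iff`).  (2) For finite `s ∋ i₀`, DENSITY (★ `NoetherDeuring.exists_smul_eq_forall_of_isAlgClosed`): `a₁ ∈ A`, `= id` on `V_{i₀}^K`,
`= 0` on `Vᵢ^K` (`i ∈ s ∖ {i₀}`).  (3) UNITARITY (★ `exists_adjoint_fixedPointsAlgHom`, ★ `exists_bound_fixedPointsAlgHom`): `b := a₁† a₁` is self-adjoint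
for every invariant form `Bᵢ`, spectrum in `[0, M²]`.  (4) `e := P(b)`, `P(0)=0, P(1)=1, 0 ≤ P ≤ 2` on `[0,M²]` (★ `exists_polynomial_eval_zero_eval_one_bounded`,
★ `trace_aeval_map_re_nonneg_le`): `tr(e|V_{i₀}^K) = dim`, `= 0` on `s ∖ {i₀}`, `∈ [0, 2 dim Vᵢ^K]` always.  (5) The hypothesis passes from the indicators
`𝟙_{KgK}` to all of `A` (★ `real_smul_trace_fixedPointsAlgHom_doubleCosetOperator`, span induction): `‖a_{i₀}‖·dim V_{i₀}^K ≤ 2 Σ_{i ∉ s} ‖aᵢ‖ dim Vᵢ^K → 0`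
(Mathlib ★ `Summable.sum_add_tsum_subtype_compl`, ★ `tendsto_tsum_compl_atTop_zero`).  WHY UNITARY: (3)–(4) (false for non-unitary families).
HC_CM is proved only modulo the printed citations until rung 0 closes; this file is the generic theorem (count-neutral by itself; (U4) strikes the letter).

## References
* [JacquetLanglands1970] H. Jacquet, R. P. Langlands, *Automorphic Forms on GL(2)*, LNM 114 (1970), Lemma 16.1.1.
* [Rogawski1990] J. D. Rogawski, *Automorphic Representations of Unitary Groups in Three Variables*, Ann. of Math. Stud. 123 (1990), Prop. 13.8.1 p. 206.
* [DeitmarEchterhoff2014] A. Deitmar, S. Echterhoff, *Principles of Harmonic Analysis* (2014), Prop. 6.2.1.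
-/

set_option autoImplicit false

noncomputable section

open MeasureTheory MulAction Filter Topology Polynomial
open scoped Pointwise ComplexConjugate InnerProductSpace

namespace Literature.NumberTheory.Automorphic

open Literature.Algebra.Module.NoetherDeuring Literature.Analysis.InnerProduct

universe u

/-! ## §1 The representation level -/
section Main

variable {G : Type*} [Group G] [TopologicalSpace G] [IsTopologicalGroup G] [MeasurableSpace G] [BorelSpace G]
  (μ : Measure G) [μ.IsMulLeftInvariant] [IsFiniteMeasureOnCompacts μ] [μ.IsOpenPosMeasure]

omit [TopologicalSpace G] [IsTopologicalGroup G] [MeasurableSpace G] [BorelSpace G] in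
/-- An irreducible representation lives on a non-zero space (Mathlib `IsSimpleOrder` on subrepresentations). [folklore] -/
private theorem nontrivial_of_isIrreducible' {V : Type*} [AddCommGroup V] [Module ℂ V] (ρ : Representation ℂ G V)
    [ρ.IsIrreducible] : Nontrivial V := by
  by_contra h
  rw [not_nontrivial_iff_subsingleton] at h
  have : (⊥ : Subrepresentation ρ) = ⊤ := Subrepresentation.toSubmodule_injective (Subsingleton.elim _ _)
  exact (IsSimpleOrder.bot_ne_top (α := Subrepresentation ρ)) this

omit [TopologicalSpace G] [IsTopologicalGroup G] [MeasurableSpace G] [BorelSpace G] in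
/-- The positive definite Hermitian form `B|_{V^K}` as an inner-product CORE on `V^K` (Mathlib `InnerProductSpace.Core`), for an invariant
positive definite Hermitian `B` on `V` — the unitary structure in which `b = a† a` is self-adjoint. [cite: DeitmarEchterhoff2014, Prop. 6.2.1] -/
private theorem exists_core_fixedPoints {V : Type} [AddCommGroup V] [Module ℂ V] (ρ : Representation ℂ G V) (K : Subgroup G)
    (B : V →ₗ⋆[ℂ] V →ₗ[ℂ] ℂ) (hBs : B.IsSymm) (hpos : ∀ v : V, v ≠ 0 → 0 < (B v v).re) :
    ∃ cd : InnerProductSpace.Core ℂ (ρ.fixedPoints K), ∀ x y : ρ.fixedPoints K, cd.inner x y = B (x : V) y := by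
  have hnn : ∀ v : V, 0 ≤ (B v v).re := fun v => by
    by_cases hv : v = 0
    · rw [hv]; simp
    · exact (hpos v hv).le
  let cd : InnerProductSpace.Core ℂ (ρ.fixedPoints K) :=
    { inner := fun x y => B (x : V) y
      conj_inner_symm := fun x y => hBs.eq (y : V) x
      re_inner_nonneg := fun x => hnn x
      add_left := fun x y z => by rw [Submodule.coe_add, map_add, LinearMap.add_apply]
      smul_left := fun x y r => by rw [Submodule.coe_smul, LinearMap.map_smulₛₗ, LinearMap.smul_apply, smul_eq_mul]
      definite := fun x hx0 => by
        have hx0' : B (x : V) x = 0 := hx0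
        by_contra hx
        have hx' : (x : V) ≠ 0 := fun h => hx ((Submodule.coe_eq_zero).mp h)
        have h1 := hpos _ hx'
        rw [hx0'] at h1
        exact absurd h1 (by simp) }
  exact ⟨cd, fun x y => rfl⟩

omit [TopologicalSpace G] [IsTopologicalGroup G] [MeasurableSpace G] [BorelSpace G] in
/-- ★ `trace_aeval_map_re_nonneg_le` READ THROUGH A CORE `cd` on a finite-dimensional complex space: `T` symmetric for `cd.inner` with
`0 ≤ re ⟨Tx,x⟩ ≤ R·re ⟨x,x⟩`, `P` real with `0 ≤ P ≤ C` on `[0,R]` ⇒ `0 ≤ re tr P(T) ≤ C·dim`, `im tr P(T) = 0` — the trace of the GIVEN module structure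
(Mathlib ★ `InnerProductSpace.ofCore` is put on `E` inside the proof only). [cite: JacquetLanglands1970, Lemma 16.1.1] -/
private theorem trace_aeval_re_bounds_of_core {E : Type*} [AddCommGroup E] [Module ℂ E] [FiniteDimensional ℂ E]
    (cd : InnerProductSpace.Core ℂ E) (T : E →ₗ[ℂ] E) (hsymm : ∀ x y : E, cd.inner (T x) y = cd.inner x (T y)) {R C : ℝ}
    (h0 : ∀ x : E, 0 ≤ (cd.inner (T x) x).re) (hR : ∀ x : E, (cd.inner (T x) x).re ≤ R * (cd.inner x x).re)
    (P : ℝ[X]) (hP : ∀ t ∈ Set.Icc (0 : ℝ) R, 0 ≤ P.eval t ∧ P.eval t ≤ C) :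
    0 ≤ (LinearMap.trace ℂ E (aeval T (P.map (algebraMap ℝ ℂ)))).re ∧
      (LinearMap.trace ℂ E (aeval T (P.map (algebraMap ℝ ℂ)))).re ≤ C * Module.finrank ℂ E ∧
      (LinearMap.trace ℂ E (aeval T (P.map (algebraMap ℝ ℂ)))).im = 0 := by
  letI : NormedAddCommGroup E := @InnerProductSpace.Core.toNormedAddCommGroup ℂ E _ _ _ cd
  letI : InnerProductSpace ℂ E := InnerProductSpace.ofCore cd.toCore
  have hinner : ∀ x y : E, ⟪x, y⟫_ℂ = cd.inner x y := fun _ _ => rfl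
  have hT : T.IsSymmetric := fun x y => hsymm x y
  have h0' : ∀ x : E, 0 ≤ (⟪T x, x⟫_ℂ).re := h0
  have hR' : ∀ x : E, (⟪T x, x⟫_ℂ).re ≤ R * ‖x‖ ^ 2 := fun x => by
    rw [norm_sq_eq_re_inner (𝕜 := ℂ)]
    exact hR x
  have h := trace_aeval_map_re_nonneg_le hT h0' hR' P hP
  exact h

/-- **[JacquetLanglands1970, Lemma 16.1.1] ∕ [Rogawski1990, Prop. 13.8.1] (`Z = 1`), REPRESENTATION LEVEL**: `G` with a compact open subgroup `K₀`,
`μ` left-invariant (finite on compacta, positive on opens), `ρᵢ` (`i ∈ ι` countable) pairwise non-isomorphic irreducible ADMISSIBLE UNITARIZABLE, `a : ι → ℂ`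
with `i ↦ aᵢ · tr ρᵢ(f)` summable to `0` for every `f ∈ C_c^∞(G)` ⇒ `a = 0`.  Only indices with `Vᵢ^K ≠ 0` carry non-zero traces; unimodularity is NOT
used (★ `HeckeOperatorUnitaryAdjoint`). [cite: JacquetLanglands1970, Lemma 16.1.1] [cite: Rogawski1990, Prop. 13.8.1 p. 206] -/
theorem Representation.eq_zero_of_summable_mul_smoothTrace (K₀ : Subgroup G) (hK₀o : IsOpen (K₀ : Set G))
    (hK₀c : IsCompact (K₀ : Set G)) {ι : Type*} [Countable ι] {V : ι → Type} [∀ i, AddCommGroup (V i)] [∀ i, Module ℂ (V i)]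
    (ρ : ∀ i, Representation ℂ G (V i)) [∀ i, (ρ i).IsIrreducible] (hadm : ∀ i, (ρ i).IsAdmissible)
    (hunit : ∀ i, (ρ i).IsUnitarizable) (hne : ∀ i j, Nonempty ((ρ i).Equiv (ρ j)) → i = j) (a : ι → ℂ)
    (ha : ∀ f : G → ℂ, f ∈ SchwartzBruhat G →
      Summable (fun i => a i * (ρ i).smoothTrace μ f) ∧ ∑' i, a i * (ρ i).smoothTrace μ f = 0) :
    a = 0 := by
  classical
  funext i₀
  rw [Pi.zero_apply]
  -- §0 the level `K`: compact open, fixing a non-zero vector of `ρ i₀`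
  haveI : Nontrivial (V i₀) := nontrivial_of_isIrreducible' (ρ i₀)
  obtain ⟨v₀, hv₀⟩ := exists_ne (0 : V i₀)
  obtain ⟨K, hKo, hKc, hvK⟩ := exists_isCompact_isOpen_forall_mem_fixedPoints (ι := Unit) (fun _ => ρ i₀) K₀ hK₀o hK₀c
    (fun _ => v₀) fun _ => (hadm i₀).isSmooth v₀
  have hK₀ne : (ρ i₀).fixedPoints K ≠ ⊥ := (Submodule.ne_bot_iff _).mpr ⟨v₀, hvK (), hv₀⟩
  haveI := isHeckeTriple_top_of_isCompact_isOpen K hKc hKo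
  have hμK : 0 < μ.real (K : Set G) := ENNReal.toReal_pos (hKo.measure_ne_zero μ ⟨1, K.one_mem⟩) hKc.measure_lt_top.ne
  -- the `ℋ(G,K)ᵐᵒᵖ`-modules `Vᵢ^K`
  letI instMod : ∀ i, Module (heckeAlgebra ℂ G K)ᵐᵒᵖ ((ρ i).fixedPoints K) := fun i =>
    Module.compHom ((ρ i).fixedPoints K) (heckeAlgebra.fixedPointsAlgHom K (ρ i)).toRingHom
  have hsmul : ∀ (i : ι) (x : (heckeAlgebra ℂ G K)ᵐᵒᵖ) (m : (ρ i).fixedPoints K),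
      x • m = heckeAlgebra.fixedPointsAlgHom K (ρ i) x m := fun _ _ _ => rfl
  haveI instTower : ∀ i, IsScalarTower ℂ (heckeAlgebra ℂ G K)ᵐᵒᵖ ((ρ i).fixedPoints K) := fun i =>
    ⟨fun r x m => by rw [hsmul i (r • x) m, hsmul i x m, map_smul, LinearMap.smul_apply]⟩
  haveI instFin : ∀ i, FiniteDimensional ℂ ((ρ i).fixedPoints K) := fun i => (hadm i).finite_fixedPoints ⟨K, hKo⟩ hKc
  -- the dimensions `dᵢ := dim Vᵢ^K`
  set d : ι → ℕ := fun i => Module.finrank ℂ ((ρ i).fixedPoints K) with hd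
  have hd₀ : 0 < d i₀ := by
    rw [hd]
    exact Module.finrank_pos_iff.mpr ((Submodule.nontrivial_iff_ne_bot).mpr hK₀ne)
  -- §1 `Σᵢ ‖aᵢ‖ dᵢ < ∞` from the test function `𝟙_K`
  have hsum : Summable fun i => ‖a i‖ * (d i : ℝ) := by
    obtain ⟨hs, -⟩ := ha ((K : Set G).indicator fun _ => (1 : ℂ)) (indicator_mem_schwartzBruhat hKo hKc)
    have hs' : Summable fun i => a i * (d i : ℂ) := by
      have h := hs.mul_left ((μ.real (K : Set G) : ℂ)⁻¹)
      refine h.congr fun i => ?_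
      have hμ : (μ.real (K : Set G) : ℂ) ≠ 0 := by exact_mod_cast hμK.ne'
      rw [(ρ i).smoothTrace_indicator μ (hadm i) hKo hKc]
      show ((μ.real (K : Set G) : ℂ))⁻¹ * (a i * ((μ.real (K : Set G) : ℂ) * (d i : ℂ))) = a i * (d i : ℂ)
      rw [show ((μ.real (K : Set G) : ℂ))⁻¹ * (a i * ((μ.real (K : Set G) : ℂ) * (d i : ℂ))) =
          a i * (d i : ℂ) * (((μ.real (K : Set G) : ℂ))⁻¹ * (μ.real (K : Set G) : ℂ)) by ring, inv_mul_cancel₀ hμ, mul_one]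
    have h2 := (summable_norm_iff (E := ℂ)).mpr hs'
    refine h2.congr fun i => ?_
    rw [norm_mul, Complex.norm_natCast]
  -- §5a the trace relation for EVERY element of `ℋ(G,K)ᵐᵒᵖ`
  have hrel : ∀ e : (heckeAlgebra ℂ G K)ᵐᵒᵖ,
      Summable (fun i => a i * LinearMap.trace ℂ _ (heckeAlgebra.fixedPointsAlgHom K (ρ i) e)) ∧
        ∑' i, a i * LinearMap.trace ℂ _ (heckeAlgebra.fixedPointsAlgHom K (ρ i) e) = 0 := by
    suffices h : ∀ T : heckeAlgebra ℂ G K,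
        Summable (fun i => a i * LinearMap.trace ℂ _ (heckeAlgebra.fixedPointsAlgHom K (ρ i) (MulOpposite.op T))) ∧
          ∑' i, a i * LinearMap.trace ℂ _ (heckeAlgebra.fixedPointsAlgHom K (ρ i) (MulOpposite.op T)) = 0 by
      intro e
      simpa only [MulOpposite.op_unop] using h (MulOpposite.unop e)
    intro T
    refine Submodule.span_induction (p := fun T _ =>
        Summable (fun i => a i * LinearMap.trace ℂ _ (heckeAlgebra.fixedPointsAlgHom K (ρ i) (MulOpposite.op T))) ∧
          ∑' i, a i * LinearMap.trace ℂ _ (heckeAlgebra.fixedPointsAlgHom K (ρ i) (MulOpposite.op T)) = 0)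
      ?_ ?_ ?_ ?_ (heckeAlgebra.mem_span_range_doubleCosetOperator K T)
    · rintro _ ⟨g, rfl⟩
      obtain ⟨hs, h0⟩ := ha _ ((isLevel_indicator_doubleCoset (K := K) hKo hKc g).1.mem_schwartzBruhat
        (isLevel_indicator_doubleCoset (K := K) hKo hKc g).2)
      have hμ : (μ.real (K : Set G) : ℂ) ≠ 0 := by exact_mod_cast hμK.ne'
      have hterm : ∀ i, a i * LinearMap.trace ℂ _ (heckeAlgebra.fixedPointsAlgHom K (ρ i)
          (MulOpposite.op (heckeAlgebra.doubleCosetOperator K g))) =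
          ((μ.real (K : Set G) : ℂ)⁻¹) * (a i * (ρ i).smoothTrace μ
            ((DoubleCoset.doubleCoset g (K : Set G) K).indicator fun _ => (1 : ℂ))) := fun i => by
        rw [← real_smul_trace_fixedPointsAlgHom_doubleCosetOperator (ρ i) μ (hadm i) hKo hKc g]
        rw [show ((μ.real (K : Set G) : ℂ))⁻¹ * (a i * ((μ.real (K : Set G) : ℂ) *
            LinearMap.trace ℂ _ (heckeAlgebra.fixedPointsAlgHom K (ρ i) (MulOpposite.op (heckeAlgebra.doubleCosetOperator K g))))) =
            a i * LinearMap.trace ℂ _ (heckeAlgebra.fixedPointsAlgHom K (ρ i) (MulOpposite.op (heckeAlgebra.doubleCosetOperator K g))) *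
              (((μ.real (K : Set G) : ℂ))⁻¹ * (μ.real (K : Set G) : ℂ)) by ring, inv_mul_cancel₀ hμ, mul_one]
      refine ⟨(hs.mul_left _).congr fun i => (hterm i).symm, ?_⟩
      rw [show (fun i => a i * LinearMap.trace ℂ _ (heckeAlgebra.fixedPointsAlgHom K (ρ i)
          (MulOpposite.op (heckeAlgebra.doubleCosetOperator K g)))) = fun i => ((μ.real (K : Set G) : ℂ)⁻¹) *
          (a i * (ρ i).smoothTrace μ ((DoubleCoset.doubleCoset g (K : Set G) K).indicator fun _ => (1 : ℂ))) from funext hterm,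
        tsum_mul_left, h0, mul_zero]
    · refine ⟨?_, ?_⟩ <;> simp [summable_zero]
    · rintro S T - - ⟨hS, hS0⟩ ⟨hT, hT0⟩
      have heq : (fun i => a i * LinearMap.trace ℂ _ (heckeAlgebra.fixedPointsAlgHom K (ρ i) (MulOpposite.op (S + T)))) =
          fun i => a i * LinearMap.trace ℂ _ (heckeAlgebra.fixedPointsAlgHom K (ρ i) (MulOpposite.op S)) +
            a i * LinearMap.trace ℂ _ (heckeAlgebra.fixedPointsAlgHom K (ρ i) (MulOpposite.op T)) := by
        funext i; rw [MulOpposite.op_add, map_add, map_add, mul_add]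
      rw [heq]
      exact ⟨hS.add hT, by rw [hS.tsum_add hT, hS0, hT0, add_zero]⟩
    · rintro c T - ⟨hT, hT0⟩
      have heq : (fun i => a i * LinearMap.trace ℂ _ (heckeAlgebra.fixedPointsAlgHom K (ρ i) (MulOpposite.op (c • T)))) =
          fun i => c * (a i * LinearMap.trace ℂ _ (heckeAlgebra.fixedPointsAlgHom K (ρ i) (MulOpposite.op T))) := by
        funext i; rw [MulOpposite.op_smul, map_smul, map_smul, smul_eq_mul, mul_left_comm]
      rw [heq]
      exact ⟨hT.mul_left c, by rw [tsum_mul_left, hT0, mul_zero]⟩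
  -- §2–§5 the main estimate for a finite set `s ∋ i₀`
  have hmain : ∀ s : Finset ι, i₀ ∈ s →
      ‖a i₀‖ * (d i₀ : ℝ) ≤ 2 * ∑' i : {i // i ∉ s}, ‖a (i : ι)‖ * (d i : ℝ) := by
    intro s hs₀
    -- §2 density on the indices of `s` with `Vᵢ^K ≠ 0`
    let I := {i : ↥s // (ρ (i : ι)).fixedPoints K ≠ ⊥}
    haveI : Fintype I := by infer_instance
    let j₀ : I := ⟨⟨i₀, hs₀⟩, hK₀ne⟩
    haveI instSimple : ∀ i : I, IsSimpleModule (heckeAlgebra ℂ G K)ᵐᵒᵖ ((ρ (i : ι)).fixedPoints K) := fun i =>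
      isSimpleModule_fixedPoints K (ρ (i : ι)) i.2
    have hiso : ∀ i j : I, Nonempty ((ρ (i : ι)).fixedPoints K ≃ₗ[(heckeAlgebra ℂ G K)ᵐᵒᵖ] (ρ (j : ι)).fixedPoints K) → i = j := by
      rintro i j ⟨e⟩
      have hij : (i : ι) = (j : ι) := by
        refine hne _ _ (nonempty_equiv_of_heckeEquivariant_fixedPoints K (ρ (i : ι)) (ρ (j : ι)) i.2
          (e.restrictScalars ℂ).toLinearMap (e.restrictScalars ℂ).injective fun g v => ?_)
        have h := e.map_smul (MulOpposite.op (heckeAlgebra.doubleCosetOperator K g)) v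
        have hl : ((MulOpposite.op (heckeAlgebra.doubleCosetOperator (k := ℂ) K g)) • v : (ρ (i : ι)).fixedPoints K) =
            ⟨heckeOperator (ρ (i : ι)) K g v,
              heckeOperator_apply_mem_fixedPoints (ρ (i : ι)) K g v.2 (finite_orbit_quotient K g)⟩ := by
          rw [hsmul]
          exact Subtype.ext (coe_fixedPointsAlgHom_doubleCosetOperator_apply K (ρ (i : ι)) g v)
        rw [hl, hsmul] at h
        rw [LinearEquiv.coe_toLinearMap, LinearEquiv.restrictScalars_apply, LinearEquiv.restrictScalars_apply, h]
        exact coe_fixedPointsAlgHom_doubleCosetOperator_apply K (ρ (j : ι)) g (e v)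
      exact Subtype.ext (Subtype.ext hij)
    obtain ⟨a₁, ha₁⟩ := exists_smul_eq_forall_of_isAlgClosed (k := ℂ) (A := (heckeAlgebra ℂ G K)ᵐᵒᵖ)
      (M := fun i : I => (ρ (i : ι)).fixedPoints K) hiso (fun i => if i = j₀ then LinearMap.id else 0)
    have ha₁_id : ∀ x : (ρ i₀).fixedPoints K, heckeAlgebra.fixedPointsAlgHom K (ρ i₀) a₁ x = x := fun x => by
      have h := ha₁ j₀ x
      rw [if_pos rfl, LinearMap.id_apply] at h
      rw [← hsmul]; exact h
    have ha₁_zero : ∀ i : I, i ≠ j₀ → ∀ x : (ρ (i : ι)).fixedPoints K, heckeAlgebra.fixedPointsAlgHom K (ρ (i : ι)) a₁ x = 0 :=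
      fun i hi x => by
        have h := ha₁ i x
        rw [if_neg hi, LinearMap.zero_apply] at h
        rw [← hsmul]; exact h
    -- §3 unitarity: the forms, the adjoint `a₂`, the bound `M`, `b := a₂ * a₁`
    have hforms : ∀ i, ∃ B : V i →ₗ⋆[ℂ] V i →ₗ[ℂ] ℂ, B.IsSymm ∧ (∀ v : V i, v ≠ 0 → 0 < (B v v).re) ∧
        ∀ (g : G) (v w : V i), B (ρ i g v) (ρ i g w) = B v w := fun i => hunit i
    choose B hBs hBpos hBinv using hforms
    obtain ⟨a₂, hadj⟩ := exists_adjoint_fixedPointsAlgHom K a₁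
    obtain ⟨M₀, hM₀, hbound⟩ := exists_bound_fixedPointsAlgHom K a₁
    set M : ℝ := max M₀ 1 with hM
    have hM1 : 1 ≤ M := le_max_right _ _
    have hMsq : 1 ≤ M ^ 2 := by nlinarith
    have hbound' : ∀ (i : ι) (x : (ρ i).fixedPoints K),
        (B i (heckeAlgebra.fixedPointsAlgHom K (ρ i) a₁ x : V i) (heckeAlgebra.fixedPointsAlgHom K (ρ i) a₁ x : V i)).re ≤
          M ^ 2 * (B i (x : V i) x).re := fun i x => by
      refine (hbound (ρ i) (B i) (hBs i) (hBpos i) (hBinv i) x).trans ?_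
      have hnn : 0 ≤ (B i (x : V i) x).re := by
        by_cases hx : (x : V i) = 0
        · rw [hx]; simp
        · exact (hBpos i _ hx).le
      exact mul_le_mul_of_nonneg_right (pow_le_pow_left₀ hM₀ (le_max_left _ _) 2) hnn
    set b : (heckeAlgebra ℂ G K)ᵐᵒᵖ := a₂ * a₁ with hb
    -- §4 the polynomial and `e := P(b)`
    obtain ⟨P, hP0, hP1, hP⟩ := exists_polynomial_eval_zero_eval_one_bounded hMsq
    set e : (heckeAlgebra ℂ G K)ᵐᵒᵖ := aeval b (P.map (algebraMap ℝ ℂ)) with he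
    -- the operators `Tᵢ := e|Vᵢ^K = P(b|Vᵢ^K)`
    have hTe : ∀ i, heckeAlgebra.fixedPointsAlgHom K (ρ i) e =
        aeval (heckeAlgebra.fixedPointsAlgHom K (ρ i) b) (P.map (algebraMap ℝ ℂ)) := fun i => by
      rw [he, aeval_algHom_apply]
    -- (4a) at `i₀`: `b = id`, so `tr Tᵢ₀ = dᵢ₀`
    have hb_id : heckeAlgebra.fixedPointsAlgHom K (ρ i₀) b = 1 := by
      apply LinearMap.ext
      intro y
      -- `a₂ y = y` by non-degeneracy of `B i₀` on `V^K`: `B(x, a₂ y) = B(a₁ x, y) = B(x, y)` for all `x`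
      have ha₂ : heckeAlgebra.fixedPointsAlgHom K (ρ i₀) a₂ y = y := by
        have hzero : ∀ x : (ρ i₀).fixedPoints K,
            B i₀ (x : V i₀) ((heckeAlgebra.fixedPointsAlgHom K (ρ i₀) a₂ y - y : (ρ i₀).fixedPoints K) : V i₀) = 0 := fun x => by
          rw [Submodule.coe_sub, map_sub, ← hadj (ρ i₀) (B i₀) (hBinv i₀) x y, ha₁_id x, sub_self]
        have hcoe : ((heckeAlgebra.fixedPointsAlgHom K (ρ i₀) a₂ y - y : (ρ i₀).fixedPoints K) : V i₀) = 0 := by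
          by_contra hne'
          have h1 := hBpos i₀ _ hne'
          rw [hzero] at h1
          exact absurd h1 (by simp)
        exact sub_eq_zero.mp ((Submodule.coe_eq_zero).mp hcoe)
      rw [hb, map_mul, Module.End.mul_apply, ha₁_id, ha₂, Module.End.one_apply]
    have htr₀ : LinearMap.trace ℂ _ (heckeAlgebra.fixedPointsAlgHom K (ρ i₀) e) = (d i₀ : ℂ) := by
      rw [hTe, hb_id, show (1 : Module.End ℂ ((ρ i₀).fixedPoints K)) = algebraMap ℂ _ 1 from (map_one _).symm,
        aeval_algebraMap_apply_eq_algebraMap_eval, eval_map, eval₂_at_one, hP1, map_one, map_one,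
        Module.End.one_eq_id, LinearMap.trace_id]
    -- (4b) on `s ∖ {i₀}`: `tr Tᵢ = 0`
    have htr_s : ∀ i ∈ s, i ≠ i₀ → LinearMap.trace ℂ _ (heckeAlgebra.fixedPointsAlgHom K (ρ i) e) = 0 := by
      intro i hi hii
      by_cases hbot : (ρ i).fixedPoints K = ⊥
      · haveI : Subsingleton ((ρ i).fixedPoints K) :=
          not_nontrivial_iff_subsingleton.mp fun h => (Submodule.nontrivial_iff_ne_bot.mp h) hbot
        rw [Subsingleton.elim (heckeAlgebra.fixedPointsAlgHom K (ρ i) e) 0, map_zero]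
      · let j : I := ⟨⟨i, hi⟩, hbot⟩
        have hj : j ≠ j₀ := fun h => hii (congrArg (fun t : I => ((t : ↥s) : ι)) h)
        have hb0 : heckeAlgebra.fixedPointsAlgHom K (ρ i) b = 0 := by
          apply LinearMap.ext
          intro y
          rw [hb, map_mul, Module.End.mul_apply, ha₁_zero j hj y, map_zero, LinearMap.zero_apply]
        rw [hTe, hb0, show (0 : Module.End ℂ ((ρ i).fixedPoints K)) = algebraMap ℂ _ 0 from (map_zero _).symm,
          aeval_algebraMap_apply_eq_algebraMap_eval, eval_map, eval₂_at_zero, coeff_zero_eq_eval_zero, hP0, map_zero, map_zero, map_zero]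
    -- (4c) for ALL `i`: `tr Tᵢ` is real, in `[0, 2 dᵢ]`
    have htr_all : ∀ i, 0 ≤ (LinearMap.trace ℂ _ (heckeAlgebra.fixedPointsAlgHom K (ρ i) e)).re ∧
        (LinearMap.trace ℂ _ (heckeAlgebra.fixedPointsAlgHom K (ρ i) e)).re ≤ 2 * (d i : ℝ) ∧
        (LinearMap.trace ℂ _ (heckeAlgebra.fixedPointsAlgHom K (ρ i) e)).im = 0 := by
      intro i
      obtain ⟨cd, hcd⟩ := exists_core_fixedPoints (ρ i) K (B i) (hBs i) (hBpos i)
      have hadj' := sesq_mul_adjoint_apply K (ρ i) (B i) (hBs i) (hadj (ρ i) (B i) (hBinv i))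
      rw [hTe i]
      refine trace_aeval_re_bounds_of_core cd (heckeAlgebra.fixedPointsAlgHom K (ρ i) b) (fun x y => ?_) (fun x => ?_)
        (fun x => ?_) P hP
      · rw [hcd, hcd, hb, (hadj' x y).1, (hadj' x y).2]
      · rw [hcd, hb, (hadj' x x).1]
        by_cases hx : (heckeAlgebra.fixedPointsAlgHom K (ρ i) a₁ x : V i) = 0
        · rw [hx]; simp
        · exact (hBpos i _ hx).le
      · rw [hcd, hcd, hb, (hadj' x x).1]
        exact hbound' i x
    -- §5 the estimate
    obtain ⟨hse, hse0⟩ := hrel e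
    obtain ⟨F, hF⟩ : ∃ F : ι → ℂ, ∀ i, F i = a i * LinearMap.trace ℂ _ (heckeAlgebra.fixedPointsAlgHom K (ρ i) e) :=
      ⟨_, fun i => rfl⟩
    have hFeq : (fun i => a i * LinearMap.trace ℂ _ (heckeAlgebra.fixedPointsAlgHom K (ρ i) e)) = F := funext fun i => (hF i).symm
    rw [hFeq] at hse hse0
    have hcs : ∑ i ∈ s, F i = a i₀ * (d i₀ : ℂ) := by
      rw [Finset.sum_eq_single_of_mem i₀ hs₀ fun i hi hii => by rw [hF, htr_s i hi hii, mul_zero], hF, htr₀]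
    have htail : a i₀ * (d i₀ : ℂ) = - ∑' i : {i // i ∉ s}, F i := by
      rw [← hcs, eq_neg_iff_add_eq_zero, hse.sum_add_tsum_subtype_compl s, hse0]
    have hcn : Summable fun i => ‖F i‖ := (summable_norm_iff (E := ℂ)).mpr hse
    have hbd : ∀ i, ‖F i‖ ≤ 2 * (‖a i‖ * (d i : ℝ)) := fun i => by
      obtain ⟨h1, h2, h3⟩ := htr_all i
      have hreal : LinearMap.trace ℂ _ (heckeAlgebra.fixedPointsAlgHom K (ρ i) e) =
          ((LinearMap.trace ℂ _ (heckeAlgebra.fixedPointsAlgHom K (ρ i) e)).re : ℂ) :=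
        Complex.ext (by simp) (by simp [h3])
      rw [hF, norm_mul, hreal, Complex.norm_real, Real.norm_of_nonneg h1]
      nlinarith [norm_nonneg (a i)]
    calc ‖a i₀‖ * (d i₀ : ℝ) = ‖a i₀ * (d i₀ : ℂ)‖ := by rw [norm_mul, Complex.norm_natCast]
      _ = ‖∑' i : {i // i ∉ s}, F i‖ := by rw [htail, norm_neg]
      _ ≤ ∑' i : {i // i ∉ s}, ‖F i‖ := norm_tsum_le_tsum_norm (hcn.subtype _)
      _ ≤ ∑' i : {i // i ∉ s}, 2 * (‖a (i : ι)‖ * (d i : ℝ)) :=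
          (hcn.subtype _).tsum_le_tsum (fun i => hbd i) ((hsum.subtype _).mul_left 2)
      _ = 2 * ∑' i : {i // i ∉ s}, ‖a (i : ι)‖ * (d i : ℝ) := tsum_mul_left
  -- §6 the tail tends to zero
  have htend : Tendsto (fun s : Finset ι => ∑' i : {i // i ∉ s}, ‖a (i : ι)‖ * (d i : ℝ)) atTop (𝓝 0) :=
    tendsto_tsum_compl_atTop_zero fun i => ‖a i‖ * (d i : ℝ)
  have hle : ‖a i₀‖ * (d i₀ : ℝ) ≤ 0 := by
    refine le_of_forall_pos_lt_add fun ε hε => ?_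
    have hev : ∀ᶠ s : Finset ι in atTop, ∑' i : {i // i ∉ s}, ‖a (i : ι)‖ * (d i : ℝ) < ε / 2 :=
      (htend.eventually (gt_mem_nhds (half_pos hε)))
    obtain ⟨s, hs⟩ := (hev.and (eventually_ge_atTop {i₀})).exists
    have hi₀ : i₀ ∈ s := Finset.singleton_subset_iff.mp hs.2
    have h := hmain s hi₀
    linarith [hs.1]
  have hd₀' : (0 : ℝ) < d i₀ := by exact_mod_cast hd₀
  have hnorm : ‖a i₀‖ ≤ 0 := by
    by_contra h
    exact absurd hle (not_le.mpr (mul_pos (lt_of_not_ge h) hd₀'))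
  exact norm_le_zero_iff.mp hnorm

end Main

/-! ## §2 The class level -/

/-- **[Rogawski1990, Prop. 13.8.1] (`Z = 1`) on isomorphism classes**: for a COUNTABLE injective family of admissible unitarizable classes `cᵢ`
and coefficients `aᵢ` with `i ↦ aᵢ · tr cᵢ(f)` summable to `0` for every test `f`: `a = 0`. [cite: Rogawski1990, Prop. 13.8.1 p. 206] [cite: JacquetLanglands1970, Lemma 16.1.1] -/
theorem IrrClass.eq_zero_of_summable_mul_smoothTrace {G : Type u} [Group G] [TopologicalSpace G] [IsTopologicalGroup G]
    [MeasurableSpace G] [BorelSpace G] (μ : Measure G) [μ.IsMulLeftInvariant] [IsFiniteMeasureOnCompacts μ] [μ.IsOpenPosMeasure]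
    (K₀ : Subgroup G) (hK₀o : IsOpen (K₀ : Set G)) (hK₀c : IsCompact (K₀ : Set G))
    {ι : Type*} [Countable ι] (c : ι → IrrClass G) (hc : Function.Injective c)
    (hcu : ∀ i, (c i).IsAdmissible ∧ (c i).IsUnitarizable) (a : ι → ℂ)
    (ha : ∀ f : G → ℂ, f ∈ SchwartzBruhat G →
      Summable (fun i => a i * (c i).smoothTrace μ f) ∧ ∑' i, a i * (c i).smoothTrace μ f = 0) :
    a = 0 := by
  classical
  let r : ι → SmoothIrrep G := fun i => Quotient.out (c i)
  have hr : ∀ i, IrrClass.mk (r i) = c i := fun i => Quotient.out_eq (c i)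
  haveI : ∀ i, (r i).ρ.IsIrreducible := fun i => (r i).isIrreducible
  have hadm : ∀ i, (r i).ρ.IsAdmissible := fun i => by
    have h := (hcu i).1
    rw [← hr i, IrrClass.isAdmissible_mk] at h
    exact h
  have hunit : ∀ i, (r i).ρ.IsUnitarizable := fun i => by
    have h := (hcu i).2
    rw [← hr i, IrrClass.isUnitarizable_mk] at h
    exact h
  have hne : ∀ i j, Nonempty ((r i).ρ.Equiv (r j).ρ) → i = j := fun i j h =>
    hc (by rw [← hr i, ← hr j]; exact (IrrClass.mk_eq_mk_iff _ _).mpr h)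
  have ha' : ∀ f : G → ℂ, f ∈ SchwartzBruhat G →
      Summable (fun i => a i * (r i).ρ.smoothTrace μ f) ∧ ∑' i, a i * (r i).ρ.smoothTrace μ f = 0 := fun f hf => by
    have h := ha f hf
    simp only [← hr, IrrClass.smoothTrace_mk] at h
    exact h
  exact Representation.eq_zero_of_summable_mul_smoothTrace μ K₀ hK₀o hK₀c (fun i => (r i).ρ) hadm hunit hne a ha'

end Literature.NumberTheory.Automorphic

end
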